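import Summits.Ventures.PercRepro.S1NineSixRankSevenTen

/-!
# PercRepro — THE `(9, 6)` SHAPE `(rank 7 on 9) ⊕ U_{2,6}` AT `(9, 4)` (p2, gen 28; SUBCLAIM-S1 §6.10 (xvii)(q);
PARTIAL — towards the `(9, 6)` capstone)

`M` coloop-free of rank `7` on `9` points with all pairs of rank `2` (a corank-`2` part), `N` a `6`-point line. Only the
slice `(7, 2)` survives on the `U`-side: `#U ≤ 64 · s₇ ≤ 64 · 36`; `#Y ≥ 57 f(3) + 63 f(4) + 64 f(5) + 64 f(6) + 7 f(7)`
with the rank classes of `9` points: the crude bounds close with margin `≥ 9,000`. Nothing is claimed about any cell.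

* `consumer_arith_seven_nine_line_six`, `c025_nine_four_disjointSum_seven_nine_line_six`.
Axioms: standard.
-/

open scoped Matroid

namespace PercRepro

namespace S1

open Set

variable {α : Type}

/-- The arithmetic of `(rank 7 on 9) ⊕ U_{2,6}` at `(9, 4)`. -/
theorem consumer_arith_seven_nine_line_six {u y t r33 r43 r44 r54 r55 r65 r66 r76 r77 F3 F4 F5 F6 F7 : ℚ}
    (hU : u ≤ 64 * r77) (hY : 57 * F3 + 63 * F4 + 64 * F5 + 64 * F6 + 7 * F7 ≤ y)
    (hF3 : r33 + r43 ≤ F3) (hF4 : r44 + r54 ≤ F4) (hF5 : r55 + r65 ≤ F5) (hF6 : r66 + r76 ≤ F6)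
    (h3 : 84 ≤ t + r33) (h4 : 126 ≤ r43 + r44) (h5 : 126 ≤ r54 + r55) (h6 : 84 ≤ r65 + r66) (h7 : 36 ≤ r76 + r77)
    (ht : 3 * t ≤ 1 * 36) (hr77 : r77 ≤ 36) (hr43 : r43 ≤ 126) (hr54 : r54 ≤ 126)
    (hF7 : 0 ≤ F7) : 42 / 5 * u ≤ y := by
  linarith

/-- **`M ⊕ U_{2,6}` at `(9, 4)`**: `M` coloop-free of rank `7` on `9` points with all pairs of rank `2`, `N` a `6`-point
line. -/
theorem c025_nine_four_disjointSum_seven_nine_line_six (M N : Matroid α) [M.Finite] [N.Finite]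
    (h : Disjoint M.E N.E) (hM : M.eRank = ((7 : ℕ) : ℕ∞)) (hME : M.E.ncard = 9) (hcolM : M.coloops = ∅)
    (hpairsM : ∀ e ∈ M.E, ∀ f ∈ M.E, e ≠ f → M.eRk {e, f} = 2) (hN : N.eRank = ((2 : ℕ) : ℕ∞))
    (hNE : N.E.ncard = 6) (hpairsN : ∀ e ∈ N.E, ∀ f ∈ N.E, e ≠ f → N.eRk {e, f} = 2) :
    phiK 9 4 * ({A : Set α | A ⊆ (M.disjointSum N h).E ∧ (M.disjointSum N h).eRk A = ((9 : ℕ) : ℕ∞) ∧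
        (M.disjointSum N h).eRk ((M.disjointSum N h).E \ A) = ((4 : ℕ) : ℕ∞)}.ncard : ℚ) ≤
      ({A : Set α | A ⊆ (M.disjointSum N h).E ∧ ((4 : ℕ) : ℕ∞) < (M.disjointSum N h).eRk A ∧
        (M.disjointSum N h).eRk A < ((9 : ℕ) : ℕ∞)}.ncard : ℚ) := by
  -- `N_M(7, 2) ≤ s₇`: a spanning set with a complement of rank `2` on `9` points has exactly `7` points
  have h72 : (profileSet M 7 2).ncard ≤ (rkSets M 7 7).ncard := by
    refine ncard_le_ncard (fun A hA => ?_) (rkSets_finite 7 7)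
    obtain ⟨hAE, hA7, hAc⟩ := hA
    have hAfin : A.Finite := M.ground_finite.subset hAE
    have h1 : ((7 : ℕ) : ℕ∞) ≤ (A.ncard : ℕ∞) := by
      rw [← hA7, hAfin.cast_ncard_eq]; exact M.eRk_le_encard A
    have h2 : ((2 : ℕ) : ℕ∞) ≤ ((M.E \ A).ncard : ℕ∞) := by
      rw [← hAc, (M.ground_finite.subset sdiff_subset).cast_ncard_eq]; exact M.eRk_le_encard _
    have h3 : A.ncard + (M.E \ A).ncard = M.E.ncard := by
      rw [← ncard_union_eq disjoint_sdiff_right hAfin (M.ground_finite.subset sdiff_subset), union_sdiff_cancel hAE]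
    have h1' : 7 ≤ A.ncard := by exact_mod_cast h1
    have h2' : 2 ≤ (M.E \ A).ncard := by exact_mod_cast h2
    rw [hME] at h3
    exact ⟨hAE, by omega, hA7⟩
  -- `N_N(2, 2) ≤ 2^6`
  have g22 : (profileSet N 2 2).ncard ≤ 64 := by
    have hsub : profileSet N 2 2 ⊆ 𝒫 N.E := fun A hA => hA.1
    have := ncard_le_ncard hsub N.ground_finite.finite_subsets
    rwa [ncard_powerset N.E N.ground_finite, hNE] at this
  have hU : {A : Set α | A ⊆ (M.disjointSum N h).E ∧ (M.disjointSum N h).eRk A = ((9 : ℕ) : ℕ∞) ∧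
      (M.disjointSum N h).eRk ((M.disjointSum N h).E \ A) = ((4 : ℕ) : ℕ∞)}.ncard ≤ 64 * (rkSets M 7 7).ncard := by
    rw [disjointSum_ncard_U_eq_finsum M N h 9 4, finsum_mem_coe_finset]
    have hsub : ({(7, 2)} : Finset (ℕ × ℕ)) ⊆ Finset.range (9 + 1) ×ˢ Finset.range (4 + 1) := by decide
    rw [← Finset.sum_subset hsub ?_]
    · rw [Finset.sum_singleton]
      dsimp only
      show (profileSet M 7 2).ncard * (profileSet N 2 2).ncard ≤ _
      have := Nat.mul_le_mul h72 g22
      linarith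
    · rintro ⟨a, b⟩ hmem hnot
      rw [Finset.mem_product, Finset.mem_range, Finset.mem_range] at hmem
      simp only [Finset.mem_singleton, Prod.mk.injEq, not_and] at hnot
      dsimp only
      rcases Nat.lt_or_ge 7 a with ha | ha
      · rw [profileSet_eq_empty_of_eRank_lt M hM ha b, ncard_empty, zero_mul]
      rcases Nat.lt_or_ge a 7 with ha' | ha'
      · have h9a : 2 < 9 - a := by omega
        rw [profileSet_eq_empty_of_eRank_lt N hN h9a (4 - b), ncard_empty, mul_zero]
      have ha7 : a = 7 := by omega
      subst ha7
      rw [show (9 : ℕ) - 7 = 2 from rfl]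
      have hb2 : b ≠ 2 := hnot rfl
      rcases Nat.lt_or_ge b 2 with hb | hb
      · have hb' : 2 < 4 - b := by omega
        rw [profileSet_eq_empty_of_eRank_lt_snd N hN hb' 2, ncard_empty, mul_zero]
      · have hb3 : 3 ≤ b := by omega
        rw [profileSet_eq_empty_of_ncard_lt M (by rw [hME]; omega : M.E.ncard < 7 + b), ncard_empty, zero_mul]
  -- the `Y`-side: eleven slices
  have hY : 57 * (rankSet M 3).ncard + 63 * (rankSet M 4).ncard + 64 * (rankSet M 5).ncard +
      64 * (rankSet M 6).ncard + 7 * (rankSet M 7).ncard ≤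
      {A : Set α | A ⊆ (M.disjointSum N h).E ∧ ((4 : ℕ) : ℕ∞) < (M.disjointSum N h).eRk A ∧
        (M.disjointSum N h).eRk A < ((9 : ℕ) : ℕ∞)}.ncard := by
    rw [disjointSum_ncard_Y_eq_finsum M N h 9 4, finsum_mem_coe_finset]
    have hsub : ({(3, 2), (4, 1), (4, 2), (5, 0), (5, 1), (5, 2), (6, 0), (6, 1), (6, 2), (7, 0), (7, 1)} :
        Finset (ℕ × ℕ)) ⊆ (Finset.range 9 ×ˢ Finset.range 9).filter (fun x : ℕ × ℕ => 4 < x.1 + x.2 ∧ x.1 + x.2 < 9) := by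
      decide
    refine le_trans ?_ (Finset.sum_le_sum_of_subset hsub)
    rw [Finset.sum_insert (by decide), Finset.sum_insert (by decide), Finset.sum_insert (by decide),
      Finset.sum_insert (by decide), Finset.sum_insert (by decide), Finset.sum_insert (by decide),
      Finset.sum_insert (by decide), Finset.sum_insert (by decide), Finset.sum_insert (by decide),
      Finset.sum_insert (by decide), Finset.sum_singleton]
    dsimp only
    have G0 : 1 ≤ (rankSet N 0).ncard := by
      have h0 : (∅ : Set α) ∈ rankSet N 0 := ⟨empty_subset _, by rw [N.eRk_empty]; rfl⟩
      exact (ncard_pos (rankSet_finite N 0)).mpr ⟨∅, h0⟩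
    have G1 : 6 ≤ (rankSet N 1).ncard := by
      have := ncard_le_ncard_rankSet_one_of_pairs hpairsN (by omega)
      rwa [hNE] at this
    have G2 : 57 ≤ (rankSet N 2).ncard := by
      have := ncard_rankSet_two_ge_of_rank_two N hN hpairsN
      rwa [hNE, show 2 ^ 6 - 1 - 6 = 57 by decide] at this
    have e32 := Nat.mul_le_mul_left (rankSet M 3).ncard G2
    have e41 := Nat.mul_le_mul_left (rankSet M 4).ncard G1
    have e42 := Nat.mul_le_mul_left (rankSet M 4).ncard G2
    have e50 := Nat.mul_le_mul_left (rankSet M 5).ncard G0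
    have e51 := Nat.mul_le_mul_left (rankSet M 5).ncard G1
    have e52 := Nat.mul_le_mul_left (rankSet M 5).ncard G2
    have e60 := Nat.mul_le_mul_left (rankSet M 6).ncard G0
    have e61 := Nat.mul_le_mul_left (rankSet M 6).ncard G1
    have e62 := Nat.mul_le_mul_left (rankSet M 6).ncard G2
    have e70 := Nat.mul_le_mul_left (rankSet M 7).ncard G0
    have e71 := Nat.mul_le_mul_left (rankSet M 7).ncard G1
    linarith
  -- the profile of `M` (rank classes of `9` points, two sizes per rank)
  obtain ⟨h3, h4, h5, h6, h7, -⟩ := rank_classes_nine_seven hM hME hcolM hpairsM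
  have hF3 := four_rkSets_le_rankSet (M := M) 3 4 5 6 3 (by omega) (by omega) (by omega) (by omega) (by omega) (by omega)
  have hF4 := four_rkSets_le_rankSet (M := M) 4 5 6 7 4 (by omega) (by omega) (by omega) (by omega) (by omega) (by omega)
  have hF5 := four_rkSets_le_rankSet (M := M) 5 6 7 8 5 (by omega) (by omega) (by omega) (by omega) (by omega) (by omega)
  have hF6 := four_rkSets_le_rankSet (M := M) 6 7 8 9 6 (by omega) (by omega) (by omega) (by omega) (by omega) (by omega)
  have hcl : ∀ x ∈ M.E, ∀ y ∈ M.E, x ≠ y → (M.closure {x, y}).ncard ≤ 1 + 2 := by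
    intro x hx y hy hxy
    have := ncard_closure_pair_le_of_coloops' M hM (by norm_num) hcolM hpairsM hx hy hxy
    rw [hME] at this
    omega
  have ht := choose_mul_ncard_rankTwoSets_le M hpairsM (c := 1) (m := 3) hcl
  rw [hME, show Nat.choose 3 2 = 3 by decide, show Nat.choose 1 (3 - 2) = 1 by decide,
    show Nat.choose 9 2 = 36 by decide] at ht
  have hsize : ∀ k n : ℕ, (rkSets M k n).ncard ≤ Nat.choose 9 k := by
    intro k n
    have hf : {A : Set α | A ⊆ M.E ∧ A.ncard = k}.Finite := M.ground_finite.finite_subsets.subset (fun _ hA => hA.1)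
    have := ncard_le_ncard (show rkSets M k n ⊆ {A : Set α | A ⊆ M.E ∧ A.ncard = k} from fun A hA => ⟨hA.1, hA.2.1⟩) hf
    rwa [ncard_setOf_subset_ncard_eq M.ground_finite k, hME] at this
  have hs7 := hsize 7 7
  have hr43 := hsize 4 3
  have hr54 := hsize 5 4
  rw [show Nat.choose 9 7 = 36 by decide] at hs7
  rw [show Nat.choose 9 4 = 126 by decide] at hr43
  rw [show Nat.choose 9 5 = 126 by decide] at hr54
  rw [phiK_nine_four]
  generalize hu0 : {A : Set α | A ⊆ (M.disjointSum N h).E ∧ (M.disjointSum N h).eRk A = ((9 : ℕ) : ℕ∞) ∧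
      (M.disjointSum N h).eRk ((M.disjointSum N h).E \ A) = ((4 : ℕ) : ℕ∞)}.ncard = u at hU ⊢
  generalize hy0 : {A : Set α | A ⊆ (M.disjointSum N h).E ∧ ((4 : ℕ) : ℕ∞) < (M.disjointSum N h).eRk A ∧
      (M.disjointSum N h).eRk A < ((9 : ℕ) : ℕ∞)}.ncard = y at hY ⊢
  have hF3' : (rkSets M 3 3).ncard + (rkSets M 4 3).ncard ≤ (rankSet M 3).ncard := by omega
  have hF4' : (rkSets M 4 4).ncard + (rkSets M 5 4).ncard ≤ (rankSet M 4).ncard := by omega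
  have hF5' : (rkSets M 5 5).ncard + (rkSets M 6 5).ncard ≤ (rankSet M 5).ncard := by omega
  have hF6' : (rkSets M 6 6).ncard + (rkSets M 7 6).ncard ≤ (rankSet M 6).ncard := by omega
  exact consumer_arith_seven_nine_line_six (u := (u : ℚ)) (y := (y : ℚ)) (t := ((rankTwoSets M 3).ncard : ℚ))
    (r33 := ((rkSets M 3 3).ncard : ℚ)) (r43 := ((rkSets M 4 3).ncard : ℚ)) (r44 := ((rkSets M 4 4).ncard : ℚ))
    (r54 := ((rkSets M 5 4).ncard : ℚ)) (r55 := ((rkSets M 5 5).ncard : ℚ)) (r65 := ((rkSets M 6 5).ncard : ℚ))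
    (r66 := ((rkSets M 6 6).ncard : ℚ)) (r76 := ((rkSets M 7 6).ncard : ℚ)) (r77 := ((rkSets M 7 7).ncard : ℚ))
    (F3 := ((rankSet M 3).ncard : ℚ)) (F4 := ((rankSet M 4).ncard : ℚ)) (F5 := ((rankSet M 5).ncard : ℚ))
    (F6 := ((rankSet M 6).ncard : ℚ)) (F7 := ((rankSet M 7).ncard : ℚ)) (by exact_mod_cast hU) (by exact_mod_cast hY)
    (by exact_mod_cast hF3') (by exact_mod_cast hF4') (by exact_mod_cast hF5') (by exact_mod_cast hF6')
    (by exact_mod_cast h3) (by exact_mod_cast h4) (by exact_mod_cast h5) (by exact_mod_cast h6) (by exact_mod_cast h7)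
    (by exact_mod_cast ht) (by exact_mod_cast hs7) (by exact_mod_cast hr43) (by exact_mod_cast hr54)
    (Nat.cast_nonneg _)

end S1

end PercRepro
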